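import Literature.MathematicalPhysics.QuantumFieldTheory.QCDTransferMatrix
import Literature.MathematicalPhysics.QuantumLattice.TraceInequalitiesProofs
import HarnessLib

/-!
# Twisted-trace clustering bound (stub `stub_twistedClusterBound`, line `Sketch_ideator5_r2`)

Crux `stmt-QuantumFields-17498` (`ChiralGluonicCompletion`), node C1 re-sourced through Lüscher's
positive transfer operator: the time-periodic torus functional is the `(−1)^F`-twisted trace
`Tr[Γ ρ^N X] / Tr[Γ ρ^N]`.  With the normalised transfer operator split `ρ = P + R` (`P` the
rank-one vacuum projection, `R ≥ 0` the thermal part, `PR = RP = 0`) this file proves the abstract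
clustering bound `stub_twistedClusterBound` consumed (verbatim, as its first hypothesis) by
`stub_latticeGap_of_normGap_coldPressure`: the thermal terms of the twisted two-time trace are
controlled by the `ℓ²` operator norm `‖R‖` (the gap) and the entropy sum `Re Tr R^{N−t}`
(the cold-pressure number).  Pure finite-dimensional matrix analysis, no physics:

* `TwistedCluster.pow_vacuum_add_thermal`, `TwistedCluster.twistedTrace_split` — the ring algebra
  `(P+R)^m = P + R^m` (`m ≥ 1`) and the four-term vacuum/thermal expansion of
  `Tr[Γ ρ^{N−t} A ρ^t B]` (the two proved lemmas of the line's sketch, copied);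
* the trace Hölder inequality `|Tr (O X)| ≤ ‖O‖ · Re Tr X` for `X ≥ 0` is the landed
  `Literature.MathematicalPhysics.QuantumLattice.norm_trace_mul_le_opNorm_mul_re_trace`;
* `TwistedCluster.norm_le_one_of_isHermitian_of_mul_self` — a Hermitian involution is a
  contraction, `‖Γ‖ ≤ 1` (C⋆-identity `‖Γᴴ Γ‖ = ‖Γ‖²` and `‖1‖ ≤ 1`).

Throughout, `‖·‖` on `Matrix n n ℂ` is the scoped `ℓ²` operator norm of `Matrix.Norms.L2Operator`
and `PosSemidef` over `ℂ` uses `ComplexOrder`.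
-/

noncomputable section

open Matrix
open scoped Matrix.Norms.L2Operator ComplexOrder

namespace Summit.QuantumFields.QCD.Theorems.AnomalyBranch

namespace TwistedCluster

variable {n : Type*} [Fintype n] [DecidableEq n]

/-! ### Ring algebra of the vacuum/thermal splitting -/

/-- Vacuum/thermal splitting of the normalised transfer operator `ρ = P + R`
(`P` the vacuum projection, `PR = RP = 0`): `ρ^m = P + R^m` for `m ≥ 1`. -/
theorem pow_vacuum_add_thermal (P R : Matrix n n ℂ) (hP : P * P = P) (hPR : P * R = 0)
    (hRP : R * P = 0) {m : ℕ} (hm : 1 ≤ m) : (P + R) ^ m = P + R ^ m := by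
  -- copied from the line's sketch `Cruxes/ChiralGluonicCompletion/Sketch_ideator4_r2.lean`
  induction m, hm using Nat.le_induction with
  | base => simp
  | succ k hk ih =>
    have hRkP : R ^ k * P = 0 := by
      obtain ⟨j, rfl⟩ : ∃ j, k = j + 1 := ⟨k - 1, by omega⟩
      rw [pow_succ, Matrix.mul_assoc, hRP, Matrix.mul_zero]
    rw [pow_succ, ih, Matrix.add_mul, Matrix.mul_add, Matrix.mul_add, hP, hPR, hRkP,
      ← pow_succ]
    simp

/-- The four-term expansion of the twisted two-time trace
`Tr[Γ ρ^{N−t} A ρ^t B] = Tr[Γ P A P B] + Tr[Γ P A R^t B] + Tr[Γ R^{N−t} A P B] + Tr[Γ R^{N−t} A R^t B]`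
(vacuum × vacuum, vacuum–connected, and the two thermal terms). Pure ring algebra. -/
theorem twistedTrace_split (Γ P R A B : Matrix n n ℂ) (hP : P * P = P) (hPR : P * R = 0)
    (hRP : R * P = 0) {N t : ℕ} (ht : 1 ≤ t) (hNt : t + 1 ≤ N) :
    (Γ * (P + R) ^ (N - t) * A * (P + R) ^ t * B).trace =
      (Γ * P * A * P * B).trace + (Γ * P * A * R ^ t * B).trace +
        (Γ * R ^ (N - t) * A * P * B).trace + (Γ * R ^ (N - t) * A * R ^ t * B).trace := by
  -- copied from the line's sketch `Cruxes/ChiralGluonicCompletion/Sketch_ideator4_r2.lean`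
  rw [pow_vacuum_add_thermal P R hP hPR hRP ht,
    pow_vacuum_add_thermal P R hP hPR hRP (show 1 ≤ N - t by omega)]
  simp only [Matrix.mul_add, Matrix.add_mul, Matrix.trace_add]
  ring

/-! ### Contractions -/

/-- A Hermitian involution is a contraction: `Γᴴ = Γ` and `Γ Γ = 1` give `‖Γ‖ ≤ 1`
(C⋆-identity `‖Γᴴ Γ‖ = ‖Γ‖ ‖Γ‖` for the `ℓ²` operator norm, and `‖1‖ ≤ 1`, an equality unless
`n` is empty). -/
theorem norm_le_one_of_isHermitian_of_mul_self {Γ : Matrix n n ℂ} (hΓ : Γ.IsHermitian)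
    (hΓΓ : Γ * Γ = 1) : ‖Γ‖ ≤ 1 := by
  have h1 : ‖(1 : Matrix n n ℂ)‖ ≤ 1 := by
    rw [cstar_norm_def, map_one, ContinuousLinearMap.one_def]
    exact ContinuousLinearMap.norm_id_le
  have h : ‖Γ‖ * ‖Γ‖ ≤ 1 := by
    rw [← l2_opNorm_conjTranspose_mul_self, hΓ.eq, hΓΓ]
    exact h1
  nlinarith [norm_nonneg Γ]

/-- `‖A X^k B Γ‖ ≤ ‖A‖ ‖X‖^k ‖B‖` for a contraction `Γ` and `k ≥ 1`. -/
theorem norm_mul_pow_mul_mul_le (A X B Γ : Matrix n n ℂ) (hΓ : ‖Γ‖ ≤ 1) {k : ℕ} (hk : 0 < k) :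
    ‖A * X ^ k * B * Γ‖ ≤ ‖A‖ * ‖X‖ ^ k * ‖B‖ := by
  have hXk : ‖X ^ k‖ ≤ ‖X‖ ^ k := norm_pow_le' X hk
  calc ‖A * X ^ k * B * Γ‖ ≤ ‖A * X ^ k * B‖ * ‖Γ‖ := norm_mul_le _ _
    _ ≤ ‖A * X ^ k * B‖ := mul_le_of_le_one_right (norm_nonneg _) hΓ
    _ ≤ ‖A‖ * ‖X ^ k‖ * ‖B‖ := norm_mul₃_le
    _ ≤ ‖A‖ * ‖X‖ ^ k * ‖B‖ := by gcongr

/-- `‖B (Γ X^k A)‖ ≤ ‖A‖ ‖X‖^k ‖B‖` for a contraction `Γ` and `k ≥ 1`. -/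
theorem norm_mul_mul_pow_mul_le (A X B Γ : Matrix n n ℂ) (hΓ : ‖Γ‖ ≤ 1) {k : ℕ} (hk : 0 < k) :
    ‖B * (Γ * X ^ k * A)‖ ≤ ‖A‖ * ‖X‖ ^ k * ‖B‖ := by
  have hXk : ‖X ^ k‖ ≤ ‖X‖ ^ k := norm_pow_le' X hk
  calc ‖B * (Γ * X ^ k * A)‖ ≤ ‖B‖ * ‖Γ * X ^ k * A‖ := norm_mul_le _ _
    _ ≤ ‖B‖ * (‖Γ‖ * ‖X ^ k‖ * ‖A‖) := by gcongr; exact norm_mul₃_le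
    _ ≤ ‖B‖ * (1 * ‖X‖ ^ k * ‖A‖) := by gcongr
    _ = ‖A‖ * ‖X‖ ^ k * ‖B‖ := by ring

end TwistedCluster

open TwistedCluster Literature.MathematicalPhysics.QuantumLattice in
/-- **Twisted-trace clustering bound** (abstract; `‖·‖` is the `ℓ²` operator norm of
`Matrix.Norms.L2Operator`).  Normalised transfer operator `ρ = P + R` with `P` the vacuum projection
(`P² = P`, `Pᴴ = P`, `Tr P = 1`), thermal part `R ≥ 0` with `PR = RP = 0`, fermion-parity twist `Γ`
(`Γᴴ = Γ`, `Γ² = 1`, `ΓP = P`, `ΓR = RΓ`).  Then for `1 ≤ t`, `t + 1 ≤ N`: the thermal remainder of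
the twisted two-time trace is bounded by `‖A‖‖B‖(‖R‖^{N−t} + Re Tr(R^{N−t}) · ‖R‖^t)`, the
vacuum-connected term by `‖A‖‖B‖‖R‖^t`, and the twisted normalisation by
`|Tr[Γρ^N] − 1| ≤ Re Tr(R^N)`.  (Four-term expansion `twistedTrace_split`, cyclicity of the trace,
Hölder `|Tr[O X]| ≤ ‖O‖ Re Tr X` for `X ≥ 0` with `X ∈ {P, R^{N−t}, R^N}`, and `‖Γ‖ ≤ 1`;
the commutation `ΓR = RΓ` is not needed.) -/
theorem stub_twistedClusterBound : ∀ (n : Type) [Fintype n] [DecidableEq n] (Γ P R A B : Matrix n n ℂ),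
    P * P = P → P.IsHermitian → P.trace = 1 → R.PosSemidef → P * R = 0 → R * P = 0 →
    Γ.IsHermitian → Γ * Γ = 1 → Γ * P = P → Commute Γ R →
    ∀ N t : ℕ, 1 ≤ t → t + 1 ≤ N →
      ‖(Γ * (P + R) ^ (N - t) * A * (P + R) ^ t * B).trace -
          (Γ * P * A * P * B).trace - (Γ * P * A * R ^ t * B).trace‖ ≤
        ‖A‖ * ‖B‖ * (‖R‖ ^ (N - t) + ((R ^ (N - t)).trace).re * ‖R‖ ^ t) ∧
      ‖(Γ * P * A * R ^ t * B).trace‖ ≤ ‖A‖ * ‖B‖ * ‖R‖ ^ t ∧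
      ‖(Γ * (P + R) ^ N).trace - 1‖ ≤ ((R ^ N).trace).re := by
  intro n _ _ Γ P R A B hP hPh hPtr hR hPR hRP hΓh hΓΓ hΓP _ N t ht hNt
  -- basic facts: `P ≥ 0` with `Re Tr P = 1`, `‖Γ‖ ≤ 1`
  have hPpsd : P.PosSemidef := by
    have h := posSemidef_conjTranspose_mul_self P
    rwa [hPh.eq, hP] at h
  have hPre : (P.trace).re = 1 := by rw [hPtr, Complex.one_re]
  have hΓ1 : ‖Γ‖ ≤ 1 := norm_le_one_of_isHermitian_of_mul_self hΓh hΓΓ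
  -- the contracted thermal insertion `Y = A R^t B Γ`
  have hY : ‖A * R ^ t * B * Γ‖ ≤ ‖A‖ * ‖R‖ ^ t * ‖B‖ :=
    norm_mul_pow_mul_mul_le A R B Γ hΓ1 ht
  -- (2) the vacuum-connected term `Tr[Γ P A R^t B] = Tr[(A R^t B Γ) P]`
  have h2 : ‖(Γ * P * A * R ^ t * B).trace‖ ≤ ‖A‖ * ‖B‖ * ‖R‖ ^ t := by
    have hcyc : (Γ * P * A * R ^ t * B).trace = (A * R ^ t * B * Γ * P).trace := by
      calc (Γ * P * A * R ^ t * B).trace = (Γ * P * (A * R ^ t * B)).trace := by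
            simp only [Matrix.mul_assoc]
        _ = (A * R ^ t * B * (Γ * P)).trace := trace_mul_comm _ _
        _ = (A * R ^ t * B * Γ * P).trace := by simp only [Matrix.mul_assoc]
    rw [hcyc]
    calc ‖(A * R ^ t * B * Γ * P).trace‖ ≤ ‖A * R ^ t * B * Γ‖ * (P.trace).re :=
          norm_trace_mul_le_opNorm_mul_re_trace _ hPpsd
      _ = ‖A * R ^ t * B * Γ‖ := by rw [hPre, mul_one]
      _ ≤ ‖A‖ * ‖R‖ ^ t * ‖B‖ := hY
      _ = ‖A‖ * ‖B‖ * ‖R‖ ^ t := by ring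
  refine ⟨?_, h2, ?_⟩
  · -- (1) the two thermal terms of the four-term expansion
    have hNt0 : 0 < N - t := by omega
    have hRNt : (R ^ (N - t)).PosSemidef := hR.pow (N - t)
    have hre : 0 ≤ ((R ^ (N - t)).trace).re := by
      simpa using (Complex.le_def.1 hRNt.trace_nonneg).1
    -- `Tr[Γ R^{N−t} A P B] = Tr[(B Γ R^{N−t} A) P]`
    have h3 : ‖(Γ * R ^ (N - t) * A * P * B).trace‖ ≤ ‖A‖ * ‖B‖ * ‖R‖ ^ (N - t) := by
      have hcyc : (Γ * R ^ (N - t) * A * P * B).trace =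
          (B * (Γ * R ^ (N - t) * A) * P).trace := trace_mul_cycle _ _ _
      rw [hcyc]
      calc ‖(B * (Γ * R ^ (N - t) * A) * P).trace‖
          ≤ ‖B * (Γ * R ^ (N - t) * A)‖ * (P.trace).re :=
            norm_trace_mul_le_opNorm_mul_re_trace _ hPpsd
        _ = ‖B * (Γ * R ^ (N - t) * A)‖ := by rw [hPre, mul_one]
        _ ≤ ‖A‖ * ‖R‖ ^ (N - t) * ‖B‖ := norm_mul_mul_pow_mul_le A R B Γ hΓ1 hNt0
        _ = ‖A‖ * ‖B‖ * ‖R‖ ^ (N - t) := by ring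
    -- `Tr[Γ R^{N−t} A R^t B] = Tr[(A R^t B Γ) R^{N−t}]`
    have h4 : ‖(Γ * R ^ (N - t) * A * R ^ t * B).trace‖ ≤
        ‖A‖ * ‖B‖ * ‖R‖ ^ t * ((R ^ (N - t)).trace).re := by
      have hcyc : (Γ * R ^ (N - t) * A * R ^ t * B).trace =
          (A * R ^ t * B * Γ * R ^ (N - t)).trace := by
        calc (Γ * R ^ (N - t) * A * R ^ t * B).trace
            = (Γ * R ^ (N - t) * (A * R ^ t * B)).trace := by simp only [Matrix.mul_assoc]
          _ = (A * R ^ t * B * (Γ * R ^ (N - t))).trace := trace_mul_comm _ _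
          _ = (A * R ^ t * B * Γ * R ^ (N - t)).trace := by simp only [Matrix.mul_assoc]
      rw [hcyc]
      calc ‖(A * R ^ t * B * Γ * R ^ (N - t)).trace‖
          ≤ ‖A * R ^ t * B * Γ‖ * ((R ^ (N - t)).trace).re :=
            norm_trace_mul_le_opNorm_mul_re_trace _ hRNt
        _ ≤ ‖A‖ * ‖R‖ ^ t * ‖B‖ * ((R ^ (N - t)).trace).re :=
            mul_le_mul_of_nonneg_right hY hre
        _ = ‖A‖ * ‖B‖ * ‖R‖ ^ t * ((R ^ (N - t)).trace).re := by ring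
    rw [twistedTrace_split Γ P R A B hP hPR hRP ht hNt]
    have key : (Γ * P * A * P * B).trace + (Γ * P * A * R ^ t * B).trace +
          (Γ * R ^ (N - t) * A * P * B).trace + (Γ * R ^ (N - t) * A * R ^ t * B).trace -
          (Γ * P * A * P * B).trace - (Γ * P * A * R ^ t * B).trace =
        (Γ * R ^ (N - t) * A * P * B).trace + (Γ * R ^ (N - t) * A * R ^ t * B).trace := by
      ring
    rw [key]
    calc ‖(Γ * R ^ (N - t) * A * P * B).trace + (Γ * R ^ (N - t) * A * R ^ t * B).trace‖
        ≤ ‖(Γ * R ^ (N - t) * A * P * B).trace‖ + ‖(Γ * R ^ (N - t) * A * R ^ t * B).trace‖ :=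
          norm_add_le _ _
      _ ≤ ‖A‖ * ‖B‖ * ‖R‖ ^ (N - t) + ‖A‖ * ‖B‖ * ‖R‖ ^ t * ((R ^ (N - t)).trace).re :=
          add_le_add h3 h4
      _ = ‖A‖ * ‖B‖ * (‖R‖ ^ (N - t) + ((R ^ (N - t)).trace).re * ‖R‖ ^ t) := by ring
  · -- (3) the twisted normalisation `Tr[Γ ρ^N] = Tr P + Tr[Γ R^N] = 1 + Tr[Γ R^N]`
    have hRN : (R ^ N).PosSemidef := hR.pow N
    have hre : 0 ≤ ((R ^ N).trace).re := by
      simpa using (Complex.le_def.1 hRN.trace_nonneg).1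
    have hpow : (P + R) ^ N = P + R ^ N := pow_vacuum_add_thermal P R hP hPR hRP (by omega)
    have hΓPtr : (Γ * P).trace = 1 := by rw [hΓP, hPtr]
    have key : (Γ * (P + R) ^ N).trace - 1 = (Γ * R ^ N).trace := by
      rw [hpow, Matrix.mul_add, trace_add, hΓPtr]
      ring
    rw [key]
    calc ‖(Γ * R ^ N).trace‖ ≤ ‖Γ‖ * ((R ^ N).trace).re :=
          norm_trace_mul_le_opNorm_mul_re_trace Γ hRN
      _ ≤ 1 * ((R ^ N).trace).re := mul_le_mul_of_nonneg_right hΓ1 hre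
      _ = ((R ^ N).trace).re := one_mul _

end Summit.QuantumFields.QCD.Theorems.AnomalyBranch
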